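import Mathlib
import HarnessLib
import Literature.MathematicalPhysics.QuantumLattice.GrassmannGaussConvBinomialGram
import Literature.MathematicalPhysics.QuantumLattice.GrassmannEffectiveActionGradedDB
import Literature.MathematicalPhysics.QuantumLattice.GrassmannLinearSubstitution
import Summits.HubbardSuperconductivity.HubbardSuperconductivity.Theorems.KLProgrammeKLRegimeEngineScaleZeroTransferGram

/-!
# K3 ENGINE-FLOW child (stmt-HubbardSuperconductivity-20437 `KLRegimeEngineV17F2`), v2 class #5 at scale `0`: the SMEARING TRANSFER of the
# ultraviolet pair amplitude is `O(U²)` for EVERY admissible smearing covariance — `‖𝒱₄(e^{Δ_D}𝒱₀)(Q;k,k′) − 𝒞₀(Q;k,k′)‖ ≤ klTransferC R·U²`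

Cell `gate-hubbard-kl`, seat hubbard-kl-k3c2-p1 g5 (scale-`0` lane; plan g17 (R47p): the `n = 0` bases of the carried invariants of the v2 skeleton are
landed theorems of this lane).  The `n = 0` member of class #5's carried invariant `PairTransferFamilyCov … 0` (p1 g11, `…EngineV8PairTransferExport`:
«the scale-`0` transfer — the `D₀`-tadpoles of the ultraviolet sextic — is an obligation of the scale-`0` lane») asks, for every covariance `D` admissible at
`(K, 0)` (`IsSoftSubCov`: normal, symbol a pointwise fraction `φ ∈ [0, 1 − w^K_{Λ₀}]` of the zero-seed propagator symbol), a bound on the `D`-smeared pair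
amplitude of the scale-`0` action against the plain one.  THE MECHANISM (why the obvious route fails and this one is `β`-uniform):

* p1's sign-blind `norm_vertexFn_gaussConv_sub_le` (`Σ_j (j!)⁻¹·(line mass)^j·sup|𝒱_{4+2j}|`) is unusable: the sups of the antisymmetrised vertex functions of
  `𝒱₀` grow like `(2j)!` (labelled-leg tree count) and no L¹/determinant kernel bound controls them without that factorial;
* the DETERMINANT route does: `(e^{Δ_D} − 1)` in binomial–Gram form (`GrassmannGaussConvBinomialGram.sum_norm_kernel_gaussConv_sub_le_binomial_of_gramBounded`:
  the `2m′ − 4` contracted fields of a degree-`2m′` kernel are integrated by the Gram–Hadamard bound, `γ^{2m′−4}`, NO pairing count) against the GRADED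
  pinned norms of `𝒱₀`'s kernels (`GrassmannEffectiveActionGradedDB`: degree `2m′` is `O(θ^{m′−2})`, k3c2-p1 g2) — a GEOMETRIC series in `4γ²θ/κ₀²`;
* the soft line's Gram constant is its symbol's phase-space MASS (`HubbardGridSymbolMassGram`), `γ² = (βL²)⁻¹Σ φ/√(ω² + e_K²) ≤ (βL²)⁻¹Σ (1 − w^K_{Λ₀})/√(…) ≤ 6047`
  (`infraredGram_frame_le`, k3c4-p1) — `β`-UNIFORM although the line's decay constant is thermal (which is why no determinant STEP in `D` is available and only
  the moment bound may be used on the soft line);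
* ONE value conversion at degree `4` (`norm_vertexFn_map_hubbardGridSub_le_of_pinned`, the (E2)₀ pattern of p3's `norm_klPairAmplitude_zero_sub_le_of_gridStep`).

Contents (part 1 = `…ScaleZeroTransferGram`: the soft line's Gram constant `isGramBoundedR_gridSub_softSubCov_zero` and the series majorant
`sum_ite_choose_graded_le`): §2 `norm_klCovSmearedPairAmplitude_zero_sub_le_of_gridStep` (parametric step data, any `D` with `IsGramBoundedR (SᵀDS) γ`, `4γ²θ/ρ² ≤ 1/2`);
§3 `…_of_frameOK` (κ₀ = ρ = √(2(7+6047)), γ² = 6047); §4 **`klTransferC R`** (closed) and **`norm_klCovSmearedPairAmplitude_zero_sub_le_sq`**: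
`‖klCovSmearedPairAmplitude … K 0 D Q k k′ − klPairAmplitude … K 0 Q k k′‖ ≤ klTransferC R · U²` for `R.WF`, `0 < U ≤ 1`, `klScaleZeroThetaC R·U ≤ 1/4`, `β³ ≤ M`.
Nothing about the model is asserted beyond these implications; nothing asserts superconductivity.
-/

noncomputable section

namespace Summit.HubbardSuperconductivity.HubbardSuperconductivity.Theorems.EngineV8

set_option linter.dupNamespace false -- summit = problem name (single-conjunct summit), D-0017

open Real Finset Literature.MathematicalPhysics.QuantumLattice Literature.Probability.LatticeModels
open Literature.MathematicalPhysics.QuantumLattice.GrassmannAlgebra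
open Summit.HubbardSuperconductivity.HubbardSuperconductivity.Theorems.KLRegimeSplit
open Summit.HubbardSuperconductivity.HubbardSuperconductivity.Theorems.KLProgrammeLegKernels
open Summit.HubbardSuperconductivity.HubbardSuperconductivity.Theorems.ScaleZeroDecay

variable {L M : ℕ} [NeZero L]

/-! ## §2 The smearing transfer at scale `0` from the step data and a Gram-bounded soft line -/

/-- **The smearing transfer of the scale-`0` pair amplitude from ONE determinant-bounded step and a Gram-bounded soft line** (class #5 at `n = 0`,
modulo the step data).  Let `N = 4M`, `S = hubbardGridSub L M β N`, `C₀ = C^K_{>e₀}`, `Ṽ = V_N + 𝒩_{K,N}`, `θ = eα‖Ṽ‖_h/κ²` as in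
`norm_klPairAmplitude_zero_sub_le_of_gridStep`; if moreover `SᵀDS` is replica-Gram-bounded with constant `γ ≥ 0` and `16·γ²·θ ≤ ρ²`, then for EVERY
`Q, k, k′`: `‖𝒱₄(e^{Δ_D}𝒱₀)(Q;k,k′) − 𝒞₀(Q;k,k′)‖ ≤ (96·N/β)·(80·(eּ‖Ṽ‖_h/(1−θ))·ρ⁻⁴·(4γ²θ/ρ²))` — the `D`-tadpoles of the degree `≥ 6` kernels of
`𝒱₀`, a geometric series (binomial–Gram defect × graded determinant bound). -/
theorem norm_klCovSmearedPairAmplitude_zero_sub_le_of_gridStep [NeZero M] {β : ℝ} (hβ : 0 < β) (U μ : ℝ) (K : TrigPolyC4v)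
    {κ : ℝ} (hκ : 0 < κ)
    (hGB : IsGramBoundedR ((hubbardGridSub L M β (2 * (2 * M))).transpose * hubbardCovAboveCT L M β μ 0 K klE0 *
      hubbardGridSub L M β (2 * (2 * M))) κ)
    {α : ℝ} (hα : 0 < α)
    (hrow : ∀ X, ∑ Y, ‖((hubbardGridSub L M β (2 * (2 * M))).transpose * hubbardCovAboveCT L M β μ 0 K klE0 *
      hubbardGridSub L M β (2 * (2 * M))) X Y‖ ≤ α)
    (hcol : ∀ Y, ∑ X, ‖((hubbardGridSub L M β (2 * (2 * M))).transpose * hubbardCovAboveCT L M β μ 0 K klE0 *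
      hubbardGridSub L M β (2 * (2 * M))) X Y‖ ≤ α)
    {ρ : ℝ} (hρ : 0 < ρ) {N₁ : ℝ} (hN₁ : 0 ≤ N₁)
    (hct : ∀ (j : Fin 2) (w : GridLeg (GridPoint L (2 * (2 * M)))),
      ∑ Y ∈ univ.filter (fun Y : Fin 2 → GridLeg (GridPoint L (2 * (2 * M))) => Y j = w),
        ‖kernel ℂ (hubbardGridCounterQuadratic L (2 * (2 * M)) β K) 2 Y‖ ≤ N₁)
    (hθ : Real.exp 1 * α * normV (GridLeg (GridPoint L (2 * (2 * M)))) κ ρ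
      (fun m' : ℕ => if m' = 1 then N₁ else if m' = 2 then |U| * |β| / (2 * (2 * M) : ℕ) else 0) / κ ^ 2 < 1)
    {D : Matrix (HubbardFieldIdx L M) (HubbardFieldIdx L M) ℂ} {γ : ℝ} (hγ : 0 ≤ γ)
    (hGD : IsGramBoundedR ((hubbardGridSub L M β (2 * (2 * M))).transpose * D * hubbardGridSub L M β (2 * (2 * M))) γ)
    (hy : 4 * (γ ^ 2 * (Real.exp 1 * α * normV (GridLeg (GridPoint L (2 * (2 * M)))) κ ρ
      (fun m' : ℕ => if m' = 1 then N₁ else if m' = 2 then |U| * |β| / (2 * (2 * M) : ℕ) else 0) / κ ^ 2) * ρ⁻¹ ^ 2) ≤ 1 / 2)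
    (Qm k k' : TorusSite 2 L) :
    ‖klCovSmearedPairAmplitude L M β U μ K 0 D Qm k k' - klPairAmplitude L M β U μ K 0 Qm k k'‖ ≤
      96 * ((2 * (2 * M) : ℕ) : ℝ) / β *
        (80 * (Real.exp 1 * normV (GridLeg (GridPoint L (2 * (2 * M)))) κ ρ
              (fun m' : ℕ => if m' = 1 then N₁ else if m' = 2 then |U| * |β| / (2 * (2 * M) : ℕ) else 0) /
            (1 - Real.exp 1 * α * normV (GridLeg (GridPoint L (2 * (2 * M)))) κ ρ
              (fun m' : ℕ => if m' = 1 then N₁ else if m' = 2 then |U| * |β| / (2 * (2 * M) : ℕ) else 0) / κ ^ 2)) *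
          ρ⁻¹ ^ 4 *
          (4 * (γ ^ 2 * (Real.exp 1 * α * normV (GridLeg (GridPoint L (2 * (2 * M)))) κ ρ
            (fun m' : ℕ => if m' = 1 then N₁ else if m' = 2 then |U| * |β| / (2 * (2 * M) : ℕ) else 0) / κ ^ 2) * ρ⁻¹ ^ 2))) := by
  -- notation
  set Ng : ℕ := 2 * (2 * M) with hNg
  haveI : NeZero Ng := ⟨by rw [hNg]; have := NeZero.ne M; omega⟩
  set S := hubbardGridSub L M β Ng with hS
  set C' := S.transpose * hubbardCovAboveCT L M β μ 0 K klE0 * S with hC'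
  set D' := S.transpose * D * S with hD'
  set Vt := hubbardGridInteraction L Ng β U + hubbardGridCounterQuadratic L Ng β K with hVt
  set prof : ℕ → ℝ := fun m' : ℕ => if m' = 1 then N₁ else if m' = 2 then |U| * |β| / Ng else 0 with hprof
  set nV : ℝ := normV (GridLeg (GridPoint L Ng)) κ ρ prof with hnV
  set θ : ℝ := Real.exp 1 * α * nV / κ ^ 2 with hθdef
  set A : ℝ := Real.exp 1 * nV / (1 - θ) with hA
  have hL : (0 : ℝ) < L := by exact_mod_cast Nat.pos_of_ne_zero (NeZero.ne L)
  have hnV0 : 0 ≤ nV := by rw [hnV]; exact normV_nonneg hκ.le hρ.le (klsv_profile_nonneg β U Ng hN₁)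
  have hθ0 : 0 ≤ θ := by positivity
  have hθ1 : θ < 1 := hθ
  have hA0 : 0 ≤ A := div_nonneg (by positivity) (by linarith)
  -- (1) the two amplitudes as vertex functions of grid images
  set F := effAction ℂ C' Vt with hF
  have hplain : klPairAmplitude L M β U μ K 0 Qm k k' =
      vertexFn L M β (ExteriorAlgebra.map (Matrix.toLin' S) F) 4 (pairLegs L M Qm k k') := by
    rw [klPairAmplitude, klEffectiveAction_zero_eq_map_hubbardGridSub hβ.ne' U μ K klE0]
    rfl
  have hsmear : klCovSmearedPairAmplitude L M β U μ K 0 D Qm k k' =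
      vertexFn L M β (ExteriorAlgebra.map (Matrix.toLin' S) (gaussConv ℂ D' F)) 4 (pairLegs L M Qm k k') := by
    rw [klCovSmearedPairAmplitude, klEffectiveAction_zero_eq_map_hubbardGridSub hβ.ne' U μ K klE0, gaussConv_map,
      LinearMap.toMatrix'_toLin']
    rfl
  have hdiff : klCovSmearedPairAmplitude L M β U μ K 0 D Qm k k' - klPairAmplitude L M β U μ K 0 Qm k k' =
      vertexFn L M β (ExteriorAlgebra.map (Matrix.toLin' S) (gaussConv ℂ D' F - F)) 4 (pairLegs L M Qm k k') := by
    rw [hsmear, hplain, map_sub, klsv_vertexFn_sub]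
  -- (2) the pinned kernel norms of `F` in every even degree (plain DB in degree 2, graded DB above)
  have hVt_even : Vt ∈ evenPart ℂ (GridLeg (GridPoint L Ng)) :=
    add_mem (hubbardGridInteraction_mem_evenPart β U) (hubbardGridCounterQuadratic_mem_evenPart β K)
  have hVt0 : constPart ℂ Vt = 0 := by
    rw [hVt, map_add, constPart_hubbardGridInteraction, constPart_hubbardGridCounterQuadratic, add_zero]
  have hF_even : F ∈ evenPart ℂ (GridLeg (GridPoint L Ng)) := effAction_mem_evenPart C' hVt_even hVt0
  set NF : ℕ → ℝ := fun m' => ρ⁻¹ ^ (2 * m') * A * θ ^ (m' - 2) with hNF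
  have hNF0 : ∀ m', 0 ≤ NF m' := fun m' => by positivity
  have hNF : ∀ (m' : ℕ) (j : Fin (2 * m')) (w : GridLeg (GridPoint L Ng)),
      ∑ Y ∈ univ.filter (fun Y : Fin (2 * m') → GridLeg (GridPoint L Ng) => Y j = w), ‖kernel ℂ F (2 * m') Y‖ ≤ NF m' := by
    intro m' j w
    rcases Nat.lt_or_ge m' 2 with hm | hm
    · interval_cases m'
      · exact absurd j.2 (by omega)
      · -- degree 2: the plain determinant bound
        have h := (sum_norm_kernel_effAction_le_of_gramBounded C' hκ hGB Vt hVt_even hVt0 prof (klsv_profile_nonneg β U Ng hN₁)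
          (klsv_sum_norm_kernel_gridVertex_le β U K hN₁ hct) hα hrow hcol hρ hθ).2 (m := 2 * 1) (by norm_num) j w
        refine h.trans (le_of_eq ?_)
        simp only [hNF, hA, show (1 : ℕ) - 2 = 0 from rfl, pow_zero, mul_one]
        ring
    · have hdeg : ∀ m'', 2 < m'' → ∀ Y : Fin (2 * m'') → GridLeg (GridPoint L Ng), kernel ℂ Vt (2 * m'') Y = 0 := fun m'' hm'' Y => by
        rw [hVt, kernel_add, kernel_hubbardGridInteraction_of_ne β U (by omega) Y, kernel_hubbardGridCounterQuadratic_of_ne β K (by omega) Y,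
          add_zero]
      exact (sum_norm_kernel_effAction_le_pow_of_gramBounded_quartic C' hκ hGB Vt hVt_even hVt0 prof (klsv_profile_nonneg β U Ng hN₁)
        (klsv_sum_norm_kernel_gridVertex_le β U K hN₁ hct) hdeg hα hrow hcol hρ hθ hm j w).2.trans (le_of_eq (by simp only [hNF, hA]; ring))
  -- (3) the binomial–Gram defect in degree 4, pinned, then the geometric majorant
  have hpin : ∀ w : GridLeg (GridPoint L Ng),
      ∑ W ∈ univ.filter (fun W : Fin 4 → GridLeg (GridPoint L Ng) => W ⟨0, by norm_num⟩ = w),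
        ‖kernel ℂ (gaussConv ℂ D' F - F) 4 W‖ ≤ 80 * A * ρ⁻¹ ^ 4 * (4 * (γ ^ 2 * θ * ρ⁻¹ ^ 2)) := by
    intro w
    have h := sum_norm_kernel_gaussConv_sub_le_binomial_of_gramBounded D' hγ hGD F hF_even NF hNF0 hNF (p := 2) ⟨0, by norm_num⟩ w
    refine h.trans ?_
    exact sum_ite_choose_graded_le _ hγ hθ0 (by positivity) hA0 hy
  -- (4) values from pinned grid norms
  have hdom := norm_vertexFn_map_hubbardGridSub_le_of_pinned (M := M) hβ Ng (gaussConv ℂ D' F - F) (by norm_num : 1 ≤ 4)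
    (pairLegs L M Qm k k') hpin
  rw [hdiff]
  refine hdom.trans (le_of_eq ?_)
  rw [card_gridLeg_gridPoint, show ((4 : ℕ).factorial : ℝ) = 24 by norm_num [Nat.factorial]]
  push_cast
  field_simp
  ring

/-! ## §3 At the tree's scale-`0` Gram constants -/

/-- **The smearing transfer for every admissible frame and every admissible smearing covariance, modulo the step data** — the same at
`κ₀ = ρ = √(2(7+6047))` (`isGramBoundedR_scaleZero_of_frameOK_sharp`) and `γ = √6047` (`isGramBoundedR_gridSub_softSubCov_zero`): `FrameOK R U N μ K`,
`klBetaMin ≤ β ≤ L`, `IsSoftSubCov L M β μ K 0 D`, `θ ≤ 1/4` (so that `4γ²θ/κ₀² ≤ 1/2`). -/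
theorem norm_klCovSmearedPairAmplitude_zero_sub_le_of_frameOK [NeZero M] {R : RenConsts} {U : ℝ} {Nsc : ℕ} {μ : ℝ} {K : TrigPolyC4v}
    (hK : FrameOK R U Nsc μ K) {β : ℝ} (hβ : klBetaMin ≤ β) (hβL : β ≤ L)
    {α : ℝ} (hα : 0 < α)
    (hrow : ∀ X, ∑ Y, ‖((hubbardGridSub L M β (2 * (2 * M))).transpose * hubbardCovAboveCT L M β μ 0 K klE0 *
      hubbardGridSub L M β (2 * (2 * M))) X Y‖ ≤ α)
    (hcol : ∀ Y, ∑ X, ‖((hubbardGridSub L M β (2 * (2 * M))).transpose * hubbardCovAboveCT L M β μ 0 K klE0 *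
      hubbardGridSub L M β (2 * (2 * M))) X Y‖ ≤ α)
    {N₁ : ℝ} (hN₁ : 0 ≤ N₁)
    (hct : ∀ (j : Fin 2) (w : GridLeg (GridPoint L (2 * (2 * M)))),
      ∑ Y ∈ univ.filter (fun Y : Fin 2 → GridLeg (GridPoint L (2 * (2 * M))) => Y j = w),
        ‖kernel ℂ (hubbardGridCounterQuadratic L (2 * (2 * M)) β K) 2 Y‖ ≤ N₁)
    (hθ : Real.exp 1 * α * normV (GridLeg (GridPoint L (2 * (2 * M)))) (Real.sqrt (2 * (7 + 6047))) (Real.sqrt (2 * (7 + 6047)))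
      (fun m' : ℕ => if m' = 1 then N₁ else if m' = 2 then |U| * |β| / (2 * (2 * M) : ℕ) else 0) / Real.sqrt (2 * (7 + 6047)) ^ 2 ≤ 1 / 4)
    {D : Matrix (HubbardFieldIdx L M) (HubbardFieldIdx L M) ℂ} (hD : IsSoftSubCov L M β μ K 0 D) (Qm k k' : TorusSite 2 L) :
    ‖klCovSmearedPairAmplitude L M β U μ K 0 D Qm k k' - klPairAmplitude L M β U μ K 0 Qm k k'‖ ≤
      96 * ((2 * (2 * M) : ℕ) : ℝ) / β *
        (80 * (Real.exp 1 * normV (GridLeg (GridPoint L (2 * (2 * M)))) (Real.sqrt (2 * (7 + 6047))) (Real.sqrt (2 * (7 + 6047)))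
              (fun m' : ℕ => if m' = 1 then N₁ else if m' = 2 then |U| * |β| / (2 * (2 * M) : ℕ) else 0) /
            (1 - Real.exp 1 * α * normV (GridLeg (GridPoint L (2 * (2 * M)))) (Real.sqrt (2 * (7 + 6047))) (Real.sqrt (2 * (7 + 6047)))
              (fun m' : ℕ => if m' = 1 then N₁ else if m' = 2 then |U| * |β| / (2 * (2 * M) : ℕ) else 0) / Real.sqrt (2 * (7 + 6047)) ^ 2)) *
          (Real.sqrt (2 * (7 + 6047)))⁻¹ ^ 4 *
          (4 * ((Real.sqrt 6047) ^ 2 * (Real.exp 1 * α * normV (GridLeg (GridPoint L (2 * (2 * M)))) (Real.sqrt (2 * (7 + 6047)))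
            (Real.sqrt (2 * (7 + 6047))) (fun m' : ℕ => if m' = 1 then N₁ else if m' = 2 then |U| * |β| / (2 * (2 * M) : ℕ) else 0) /
              Real.sqrt (2 * (7 + 6047)) ^ 2) * (Real.sqrt (2 * (7 + 6047)))⁻¹ ^ 2))) := by
  have hβpos : 0 < β := beta_pos_of_klBetaMin_le hβ
  have hκ : 0 < Real.sqrt (2 * (7 + 6047)) := Real.sqrt_pos.2 (by norm_num)
  set θ : ℝ := Real.exp 1 * α * normV (GridLeg (GridPoint L (2 * (2 * M)))) (Real.sqrt (2 * (7 + 6047))) (Real.sqrt (2 * (7 + 6047)))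
      (fun m' : ℕ => if m' = 1 then N₁ else if m' = 2 then |U| * |β| / (2 * (2 * M) : ℕ) else 0) / Real.sqrt (2 * (7 + 6047)) ^ 2 with hθdef
  have hθ0 : 0 ≤ θ := by
    rw [hθdef]
    exact div_nonneg (mul_nonneg (by positivity) (normV_nonneg hκ.le hκ.le (klsv_profile_nonneg β U _ hN₁))) (by positivity)
  have hθ1 : θ < 1 := by linarith
  -- `4γ²θ/κ₀² ≤ 1/2` from `θ ≤ 1/4`
  have hy : 4 * ((Real.sqrt 6047) ^ 2 * θ * (Real.sqrt (2 * (7 + 6047)))⁻¹ ^ 2) ≤ 1 / 2 := by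
    rw [Real.sq_sqrt (by norm_num), inv_pow, Real.sq_sqrt (by norm_num)]
    nlinarith
  exact norm_klCovSmearedPairAmplitude_zero_sub_le_of_gridStep hβpos U μ K hκ (isGramBoundedR_scaleZero_of_frameOK_sharp hK hβ hβL) hα
    hrow hcol hκ hN₁ hct hθ1 (Real.sqrt_nonneg _) (isGramBoundedR_gridSub_softSubCov_zero hK hβ hβL hD) hy Qm k k'

/-! ## §4 The closed constant and the explicit transfer -/

/-- **`klTransferC R`** — the `U²`-coefficient of the scale-`0` smearing transfer: `40960·e·6047·klScaleZeroCV R·klScaleZeroThetaC R/κ₀⁶`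
(`96·80·4·(4/3) = 40960`; `κ₀ = √(2(7+6047))`; the `γ² = 6047` of the soft line, the field-weighted vertex size `CV`, the step smallness `ThetaC` of
`…ScaleZeroValuesDefs`). -/
def klTransferC (R : RenConsts) : ℝ :=
  40960 * Real.exp 1 * 6047 * klScaleZeroCV R * klScaleZeroThetaC R / Real.sqrt (2 * (7 + 6047)) ^ 6

/-- `0 < klTransferC R` (`0 ≤ R.Gfr 0`). -/
theorem klTransferC_pos {R : RenConsts} (hR : 0 ≤ R.Gfr 0) : 0 < klTransferC R := by
  have h1 := klScaleZeroCV_pos hR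
  have h2 := klScaleZeroThetaC_pos hR
  have h3 : 0 < Real.sqrt (2 * (7 + 6047)) := Real.sqrt_pos.2 (by norm_num)
  unfold klTransferC; positivity

/-- **The scale-`0` smearing transfer is `O(U²)`, EXPLICIT**: for every admissible frame (`FrameOK R U N μ K`, `R.WF`), `0 < U ≤ 1`, `klBetaMin ≤ β ≤ L`,
`β³ ≤ M`, the package smallness `klScaleZeroThetaC R · U ≤ 1/4`, EVERY smearing covariance `D` admissible at `(K, 0)` and EVERY `Q, k, k′`:
`‖𝒱₄(e^{Δ_D}𝒱₀)(Q;k,k′) − 𝒞₀(Q;k,k′)‖ ≤ klTransferC R · U²`. -/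
theorem norm_klCovSmearedPairAmplitude_zero_sub_le_sq [NeZero M] {R : RenConsts} (hR : R.WF) {U : ℝ} (hU : 0 < U) (hU1 : U ≤ 1)
    {Nsc : ℕ} {μ : ℝ} {K : TrigPolyC4v} (hK : FrameOK R U Nsc μ K) {β : ℝ} (hβ : klBetaMin ≤ β) (hβL : β ≤ L)
    (hβM : β ^ 3 ≤ (M : ℝ)) (hθ : klScaleZeroThetaC R * U ≤ 1 / 4)
    {D : Matrix (HubbardFieldIdx L M) (HubbardFieldIdx L M) ℂ} (hD : IsSoftSubCov L M β μ K 0 D) (Qm k k' : TorusSite 2 L) :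
    ‖klCovSmearedPairAmplitude L M β U μ K 0 D Qm k k' - klPairAmplitude L M β U μ K 0 Qm k k'‖ ≤ klTransferC R * U ^ 2 := by
  -- notation and signs
  set Ng : ℕ := 2 * (2 * M) with hNg
  haveI : NeZero Ng := ⟨by rw [hNg]; have := NeZero.ne M; omega⟩
  have hβ0 : 0 < β := beta_pos_of_klBetaMin_le hβ
  have hN0 : 0 < ((Ng : ℕ) : ℝ) := by exact_mod_cast Nat.pos_of_ne_zero (NeZero.ne Ng)
  have hUabs : |U| = U := abs_of_pos hU
  have hU1' : |U| ≤ 1 := by rwa [hUabs]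
  have hG0 : 0 ≤ R.Gfr 0 := hR.2.2 0
  set κ₀ : ℝ := Real.sqrt (2 * (7 + 6047)) with hκ₀
  have hκ : 0 < κ₀ := Real.sqrt_pos.2 (by norm_num)
  have hA0 := klScaleZeroA0_pos
  have hCV := klScaleZeroCV_pos hG0
  -- the decay constant
  set α : ℝ := ((Ng : ℕ) : ℝ) / β * klScaleZeroA0 with hα
  have hαpos : 0 < α := by positivity
  have hrow := fun X => rowSum_scaleZero_le_A0 (L := L) (μ := μ) hK hβ hβM X
  have hcol := fun Y => colSum_scaleZero_le_A0 (L := L) (μ := μ) hK hβ hβM Y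
  -- the degree-2 size
  set kK : ℝ := klKappaFrameC R * |U| with hkK
  have hkKframe : ∑ z : TorusSite 2 L, ‖framePosKernel L K z‖ ≤ kK :=
    sum_norm_framePosKernel_le_linear_of_frameOK hR hU.ne' hU1' hK
  set N₁ : ℝ := |β| / Ng * kK with hN₁
  have hkK0 : 0 ≤ kK := by rw [hkK]; exact mul_nonneg (klKappaFrameC_pos hG0).le (abs_nonneg U)
  have hN₁0 : 0 ≤ N₁ := by positivity
  have hct : ∀ (j : Fin 2) (w : GridLeg (GridPoint L Ng)),
      ∑ Y ∈ univ.filter (fun Y : Fin 2 → GridLeg (GridPoint L Ng) => Y j = w),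
        ‖kernel ℂ (hubbardGridCounterQuadratic L Ng β K) 2 Y‖ ≤ N₁ := fun j w =>
    (sum_norm_kernel_hubbardGridCounterQuadratic_le_l1 β K j w).trans (mul_le_mul_of_nonneg_left hkKframe (by positivity))
  -- the field-weighted norm and the smallness
  set V : ℝ := normV (GridLeg (GridPoint L Ng)) κ₀ κ₀
    (fun m' : ℕ => if m' = 1 then N₁ else if m' = 2 then |U| * |β| / (Ng : ℕ) else 0) with hV
  have hVeq : V = (Real.exp 2 * (κ₀ + κ₀)) ^ 2 * (|β| / Ng * kK) + (Real.exp 2 * (κ₀ + κ₀)) ^ 4 * (|U| * |β| / Ng) := by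
    rw [hV, hN₁]
    exact normV_scaleZeroPinnedL1_eq four_le_card_gridLeg κ₀ κ₀ β U kK Ng
  have hNV : ((Ng : ℕ) : ℝ) / β * V ≤ klScaleZeroCV R * U := by
    rw [hVeq, abs_of_pos hβ0, hkK, hUabs, klScaleZeroCV, ← hκ₀, show κ₀ + κ₀ = 2 * κ₀ by ring]
    have h2 : 0 ≤ (Real.exp 2 * (2 * κ₀)) ^ 2 := sq_nonneg _
    have h4 : 0 ≤ (Real.exp 2 * (2 * κ₀)) ^ 4 := by positivity
    have hKC : 0 ≤ klKappaFrameC R := (klKappaFrameC_pos hG0).le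
    refine le_of_eq ?_
    field_simp
  have hV0 : 0 ≤ V := by
    rw [hV]; exact normV_nonneg hκ.le hκ.le (klsv_profile_nonneg β U Ng hN₁0)
  set θ : ℝ := Real.exp 1 * α * V / κ₀ ^ 2 with hθdef
  have hθle : θ ≤ klScaleZeroThetaC R * U := by
    have h1 : θ = Real.exp 1 * klScaleZeroA0 * (((Ng : ℕ) : ℝ) / β * V) / κ₀ ^ 2 := by rw [hθdef, hα]; ring
    rw [h1, klScaleZeroThetaC, ← hκ₀]
    have : Real.exp 1 * klScaleZeroA0 * (((Ng : ℕ) : ℝ) / β * V) ≤ Real.exp 1 * klScaleZeroA0 * (klScaleZeroCV R * U) :=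
      mul_le_mul_of_nonneg_left hNV (by positivity)
    calc Real.exp 1 * klScaleZeroA0 * (((Ng : ℕ) : ℝ) / β * V) / κ₀ ^ 2
        ≤ Real.exp 1 * klScaleZeroA0 * (klScaleZeroCV R * U) / κ₀ ^ 2 := div_le_div_of_nonneg_right this (by positivity)
      _ = _ := by ring
  have hθq : θ ≤ 1 / 4 := hθle.trans hθ
  have hθ0 : 0 ≤ θ := by positivity
  -- the parametric bound
  have hmain := norm_klCovSmearedPairAmplitude_zero_sub_le_of_frameOK (L := L) (M := M) hK hβ hβL hαpos hrow hcol hN₁0 hct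
    (by rw [← hκ₀]; exact hθq) hD Qm k k'
  rw [← hκ₀] at hmain
  refine hmain.trans ?_
  change 96 * ((Ng : ℕ) : ℝ) / β * (80 * (Real.exp 1 * V / (1 - θ)) * κ₀⁻¹ ^ 4 * (4 * ((Real.sqrt 6047) ^ 2 * θ * κ₀⁻¹ ^ 2))) ≤
    klTransferC R * U ^ 2
  rw [Real.sq_sqrt (by norm_num)]
  -- `V/(1−θ)·θ ≤ (β/Ng)·CV·U·(4/3)·ThetaC·U`
  have hfrac : θ / (1 - θ) ≤ 4 / 3 * (klScaleZeroThetaC R * U) := by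
    rw [div_le_iff₀ (by linarith)]
    nlinarith [mul_nonneg hθ0 (by linarith : (0:ℝ) ≤ klScaleZeroThetaC R * U)]
  have hκ4 : 0 ≤ κ₀⁻¹ ^ 4 := by positivity
  have hκ2 : 0 ≤ κ₀⁻¹ ^ 2 := by positivity
  calc 96 * ((Ng : ℕ) : ℝ) / β * (80 * (Real.exp 1 * V / (1 - θ)) * κ₀⁻¹ ^ 4 * (4 * (6047 * θ * κ₀⁻¹ ^ 2)))
      = 96 * 80 * 4 * 6047 * κ₀⁻¹ ^ 4 * κ₀⁻¹ ^ 2 * (Real.exp 1 * (((Ng : ℕ) : ℝ) / β * V)) * (θ / (1 - θ)) := by ring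
    _ ≤ 96 * 80 * 4 * 6047 * κ₀⁻¹ ^ 4 * κ₀⁻¹ ^ 2 * (Real.exp 1 * (klScaleZeroCV R * U)) * (4 / 3 * (klScaleZeroThetaC R * U)) := by
        refine mul_le_mul (mul_le_mul_of_nonneg_left (mul_le_mul_of_nonneg_left hNV (by positivity)) (by positivity)) hfrac
          (div_nonneg hθ0 (by linarith)) (by positivity)
    _ = klTransferC R * U ^ 2 := by
        rw [klTransferC, ← hκ₀]
        field_simp
        ring

end Summit.HubbardSuperconductivity.HubbardSuperconductivity.Theorems.EngineV8

end
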